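import Summits.ValiantsHypothesis.ValiantsHypothesis.Theorems.PolyaContinuedMonotoneCoverHardStubRectangleBound

/-!
# Crux `MonotoneCoverHard` (stmt-ValiantsHypothesis-7421), line `few_state_cut`: the side condition
BALEX — automatic cases (PURE covers)

Lane BalEx (val-width-7421-p3 g0, 2026-08-27).  The registered bet `stub_fewStateCut` is, in kernel
(`…BetCalibrationClosed.lean`), `WEAKEXP ∧ BALEX`, where BALEX asks that every label-bijective
(Pfaffian) cover `(m, E, a)` of `per_n` admit a vertex set `S ⊆ rows ⊔ columns` that is BALANCED for
all weight-nonzero perfect matchings `τ` at once: the number of variable-labelled edges of `τ` with both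
endpoints in `S` lies in `[n/3, 2n/3]`.  This file proves the elementary half of the calibration memo's
remark "balanced `S` exists for row-pure or column-pure covers and after even subdivision":

* `exists_perm_labels` — PERMUTATION STRUCTURE OF ONE MATCHING: the variable labels of a weight-nonzero
  perfect matching `τ` are `x_{k, σ k}`, each label-row `k` (hence each label-column) carried by EXACTLY
  ONE edge of `τ` (coefficient comparison, via val-width-7421-p1's `label_bijection`);
* `card_inside_eq_of_fst_closed` / `…_snd_closed` — if, along `τ`, "both endpoints in `S`" is
  equivalent to "label-row ∈ `A`" (resp. "label-column ∈ `B`"), the inside count of `S` is `#A`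
  (resp. `#B`) — exactly, not just within the window;
* `exists_balanced_of_rowPure_fst`, `…_rowPure_snd`, `…_colPure_fst`, `…_colPure_snd` — the four PURE
  cases: if every row vertex (resp. column vertex) of the cover sees a single label-row (resp. a single
  label-column) on its variable edges, then for `2 ≤ n` a balanced vertex set exists (one whole side plus
  the vertices of the other side whose label coordinate is `< ⌈n/2⌉`).  The trivial cover `K_{n,n}`,
  Laplace-type covers and every cover after the label-preserving even subdivision of its variable edges
  (the new column endpoint of a variable edge carries one label) are pure.

No Pfaffian hypothesis is used.  BALEX in general (label-mixing hubs on both sides) is NOT settled here;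
see the levelling / band-cut files of the same lane.  VP ≠ VNP is not moved.  No definitions.
-/

namespace Summit.ValiantsHypothesis.ValiantsHypothesis.Theorems.PolyaContinuedMonotoneCoverHard

-- summit = sub-problem name (single-conjunct summit, D-0017 layout), so the namespace repeats it
set_option linter.dupNamespace false

open scoped Classical
open Finset
open Summit.ValiantsHypothesis.ValiantsHypothesis.Theorems.PolyaContinued.MonotoneCoverHardRectangle
  (exists_labels aeval_permanent_cover perPoly_eq_sum_monomial label_bijection pexp_injective
    pexp_apply)

/-- **Permutation structure of one matching.**  In a cover of `per_n` (labels in `{X j, 0, 1}`,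
`per_n = aeval a PM_E`), the variable labels of a weight-nonzero perfect matching `τ` lie on the graph
of a permutation `σ` of `Fin n`, and every label `x_{k, σ k}` is carried by exactly one edge of `τ`. -/
theorem exists_perm_labels {m n : ℕ} (E : Finset (Fin m × Fin m))
    (a : Fin m × Fin m → MvPolynomial (Fin n × Fin n) ℂ)
    (ha : ∀ e, (∃ j, a e = MvPolynomial.X j) ∨ a e = 0 ∨ a e = 1)
    (hper : Literature.Computability.AlgebraicComplexity.perPoly (Fin n) ℂ =
      MvPolynomial.aeval a (Matrix.of fun i j => if (i, j) ∈ E then MvPolynomial.X (i, j) else 0 :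
          Matrix (Fin m) (Fin m) (MvPolynomial (Fin m × Fin m) ℂ)).permanent)
    (τ : Equiv.Perm (Fin m)) (hτ : ∀ i, (i, τ i) ∈ E ∧ a (i, τ i) ≠ 0) :
    ∃ σ : Equiv.Perm (Fin n),
      (∀ i j, a (i, τ i) = MvPolynomial.X j → σ j.1 = j.2) ∧
      (∀ k : Fin n, ∃! i : Fin m, a (i, τ i) = MvPolynomial.X (k, σ k)) := by
  obtain ⟨δ, hδ, -, hδ0⟩ := exists_labels a ha
  set G := univ.filter fun τ : Equiv.Perm (Fin m) => ∀ i, (i, τ i) ∈ E ∧ a (i, τ i) ≠ 0 with hG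
  have hsum : ∑ τ ∈ G, MvPolynomial.monomial (∑ i, δ (i, τ i)) (1 : ℂ) =
      ∑ σ : Equiv.Perm (Fin n), MvPolynomial.monomial (∑ k, Finsupp.single (k, σ k) 1) (1 : ℂ) := by
    rw [← aeval_permanent_cover E a δ hδ G hG, ← hper, perPoly_eq_sum_monomial]
  obtain ⟨-, himg, -⟩ := label_bijection G (fun τ => ∑ i, δ (i, τ i))
    (fun σ : Equiv.Perm (Fin n) => ∑ k, Finsupp.single (k, σ k) (1 : ℕ)) pexp_injective hsum
  have hτG : τ ∈ G := by rw [hG]; exact mem_filter.2 ⟨mem_univ _, hτ⟩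
  obtain ⟨σ, hσ⟩ := himg τ hτG
  -- the exponent of the edge at row `i`, evaluated at a label `p`
  have hval : ∀ i (p : Fin n × Fin n),
      δ (i, τ i) p = if a (i, τ i) = MvPolynomial.X p then 1 else 0 := by
    intro i p
    by_cases hv : ∃ j, a (i, τ i) = MvPolynomial.X j
    · obtain ⟨j, hj⟩ := hv
      have h2 := hδ (i, τ i) (hτ i).2
      rw [hj] at h2
      have h1 : δ (i, τ i) = Finsupp.single j 1 :=
        (MvPolynomial.monomial_left_injective (one_ne_zero' ℂ) h2).symm
      rw [h1, hj, Finsupp.single_apply]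
      by_cases hjp : j = p
      · subst hjp; simp
      · rw [if_neg hjp, if_neg (fun h => hjp (MvPolynomial.X_injective h))]
    · rw [hδ0 _ hv, if_neg (fun h => hv ⟨p, h⟩)]
      rfl
  have hsumval : ∀ p : Fin n × Fin n,
      (univ.filter fun i : Fin m => a (i, τ i) = MvPolynomial.X p).card =
        if σ p.1 = p.2 then 1 else 0 := by
    intro p
    have h1 : (∑ i, δ (i, τ i)) p = (∑ k, Finsupp.single (k, σ k) (1 : ℕ)) p := by rw [hσ]
    rw [pexp_apply, Finsupp.finsetSum_apply] at h1
    simp_rw [hval _ p] at h1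
    rw [Finset.sum_boole, Nat.cast_id] at h1
    exact h1
  refine ⟨σ, fun i j hij => ?_, fun k => ?_⟩
  · by_contra hne
    have h1 := hsumval j
    rw [if_neg hne, Finset.card_eq_zero] at h1
    have : i ∈ (univ.filter fun i : Fin m => a (i, τ i) = MvPolynomial.X j) :=
      mem_filter.2 ⟨mem_univ _, hij⟩
    rw [h1] at this
    exact absurd this (Finset.notMem_empty _)
  · have h1 := hsumval (k, σ k)
    rw [if_pos rfl, Finset.card_eq_one] at h1
    obtain ⟨i₀, hi₀⟩ := h1
    refine ⟨i₀, ?_, fun i hi => ?_⟩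
    · have : i₀ ∈ (univ.filter fun i : Fin m => a (i, τ i) = MvPolynomial.X (k, σ k)) := by
        rw [hi₀]; exact mem_singleton_self _
      exact (mem_filter.1 this).2
    · have : i ∈ (univ.filter fun i : Fin m => a (i, τ i) = MvPolynomial.X (k, σ k)) :=
        mem_filter.2 ⟨mem_univ _, hi⟩
      rw [hi₀] at this
      exact mem_singleton.1 this

/-- **Every weight-nonzero perfect matching has exactly `n` variable edges.** -/
theorem card_var_eq {m n : ℕ} (E : Finset (Fin m × Fin m))
    (a : Fin m × Fin m → MvPolynomial (Fin n × Fin n) ℂ)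
    (ha : ∀ e, (∃ j, a e = MvPolynomial.X j) ∨ a e = 0 ∨ a e = 1)
    (hper : Literature.Computability.AlgebraicComplexity.perPoly (Fin n) ℂ =
      MvPolynomial.aeval a (Matrix.of fun i j => if (i, j) ∈ E then MvPolynomial.X (i, j) else 0 :
          Matrix (Fin m) (Fin m) (MvPolynomial (Fin m × Fin m) ℂ)).permanent)
    (τ : Equiv.Perm (Fin m)) (hτ : ∀ i, (i, τ i) ∈ E ∧ a (i, τ i) ≠ 0) :
    (univ.filter fun i : Fin m => ∃ j, a (i, τ i) = MvPolynomial.X j).card = n := by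
  obtain ⟨σ, h1, h2⟩ := exists_perm_labels E a ha hper τ hτ
  choose f hf hf' using h2
  have hfinj : Function.Injective f := by
    intro k k' hkk'
    have := (hf k).symm.trans (hkk' ▸ hf k')
    exact (Prod.ext_iff.1 (MvPolynomial.X_injective this)).1
  have himage : (univ.filter fun i : Fin m => ∃ j, a (i, τ i) = MvPolynomial.X j) = univ.image f := by
    ext i
    simp only [mem_filter, mem_univ, true_and, mem_image]
    constructor
    · rintro ⟨j, hj⟩
      have hj2 : j = (j.1, σ j.1) := Prod.ext rfl (h1 i j hj).symm
      exact ⟨j.1, (hf' j.1 i (show a (i, τ i) = MvPolynomial.X (j.1, σ j.1) by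
        rw [← hj2]; exact hj)).symm⟩
    · rintro ⟨k, rfl⟩
      exact ⟨(k, σ k), hf k⟩
  rw [himage, card_image_of_injective _ hfinj, card_univ, Fintype.card_fin]

/-- **Inside count of a label-row-closed vertex set.**  If along the weight-nonzero perfect matching
`τ` a variable edge has both endpoints in `S` exactly when its label-row lies in `A`, then `S` contains
both endpoints of exactly `#A` variable edges of `τ`. -/
theorem card_inside_eq_of_fst_closed {m n : ℕ} (E : Finset (Fin m × Fin m))
    (a : Fin m × Fin m → MvPolynomial (Fin n × Fin n) ℂ)
    (ha : ∀ e, (∃ j, a e = MvPolynomial.X j) ∨ a e = 0 ∨ a e = 1)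
    (hper : Literature.Computability.AlgebraicComplexity.perPoly (Fin n) ℂ =
      MvPolynomial.aeval a (Matrix.of fun i j => if (i, j) ∈ E then MvPolynomial.X (i, j) else 0 :
          Matrix (Fin m) (Fin m) (MvPolynomial (Fin m × Fin m) ℂ)).permanent)
    (τ : Equiv.Perm (Fin m)) (hτ : ∀ i, (i, τ i) ∈ E ∧ a (i, τ i) ≠ 0)
    (S : Finset (Fin m ⊕ Fin m)) (A : Finset (Fin n))
    (hS : ∀ i j, a (i, τ i) = MvPolynomial.X j → ((Sum.inl i ∈ S ∧ Sum.inr (τ i) ∈ S) ↔ j.1 ∈ A)) :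
    (univ.filter fun i : Fin m =>
        Sum.inl i ∈ S ∧ Sum.inr (τ i) ∈ S ∧ ∃ j, a (i, τ i) = MvPolynomial.X j).card = A.card := by
  obtain ⟨σ, h1, h2⟩ := exists_perm_labels E a ha hper τ hτ
  choose f hf hf' using h2
  have hfinj : Function.Injective f := by
    intro k k' hkk'
    have := (hf k).symm.trans (hkk' ▸ hf k')
    exact (Prod.ext_iff.1 (MvPolynomial.X_injective this)).1
  have himage : (univ.filter fun i : Fin m =>
      Sum.inl i ∈ S ∧ Sum.inr (τ i) ∈ S ∧ ∃ j, a (i, τ i) = MvPolynomial.X j) = A.image f := by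
    ext i
    simp only [mem_filter, mem_univ, true_and, mem_image]
    constructor
    · rintro ⟨hl, hr, j, hj⟩
      have hj2 : j = (j.1, σ j.1) := Prod.ext rfl (h1 i j hj).symm
      exact ⟨j.1, (hS i j hj).1 ⟨hl, hr⟩, (hf' j.1 i (show a (i, τ i) = MvPolynomial.X (j.1, σ j.1) by
        rw [← hj2]; exact hj)).symm⟩
    · rintro ⟨k, hk, rfl⟩
      have h3 := (hS (f k) (k, σ k) (hf k)).2 hk
      exact ⟨h3.1, h3.2, (k, σ k), hf k⟩
  rw [himage, card_image_of_injective _ hfinj]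

/-- **Inside count of a label-column-closed vertex set** (the transpose of
`card_inside_eq_of_fst_closed`). -/
theorem card_inside_eq_of_snd_closed {m n : ℕ} (E : Finset (Fin m × Fin m))
    (a : Fin m × Fin m → MvPolynomial (Fin n × Fin n) ℂ)
    (ha : ∀ e, (∃ j, a e = MvPolynomial.X j) ∨ a e = 0 ∨ a e = 1)
    (hper : Literature.Computability.AlgebraicComplexity.perPoly (Fin n) ℂ =
      MvPolynomial.aeval a (Matrix.of fun i j => if (i, j) ∈ E then MvPolynomial.X (i, j) else 0 :
          Matrix (Fin m) (Fin m) (MvPolynomial (Fin m × Fin m) ℂ)).permanent)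
    (τ : Equiv.Perm (Fin m)) (hτ : ∀ i, (i, τ i) ∈ E ∧ a (i, τ i) ≠ 0)
    (S : Finset (Fin m ⊕ Fin m)) (B : Finset (Fin n))
    (hS : ∀ i j, a (i, τ i) = MvPolynomial.X j → ((Sum.inl i ∈ S ∧ Sum.inr (τ i) ∈ S) ↔ j.2 ∈ B)) :
    (univ.filter fun i : Fin m =>
        Sum.inl i ∈ S ∧ Sum.inr (τ i) ∈ S ∧ ∃ j, a (i, τ i) = MvPolynomial.X j).card = B.card := by
  obtain ⟨σ, h1, -⟩ := exists_perm_labels E a ha hper τ hτ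
  have hAB : (B.image σ.symm).card = B.card := card_image_of_injective _ σ.symm.injective
  rw [← hAB]
  refine card_inside_eq_of_fst_closed E a ha hper τ hτ S (B.image σ.symm) fun i j hj => ?_
  rw [hS i j hj]
  have hj2 : σ j.1 = j.2 := h1 i j hj
  constructor
  · intro h
    exact mem_image.2 ⟨j.2, h, by rw [← hj2, Equiv.symm_apply_apply]⟩
  · intro h
    obtain ⟨l, hl, hl'⟩ := mem_image.1 h
    have : l = j.2 := by rw [← hj2, ← hl', Equiv.apply_symm_apply]
    rw [← this]; exact hl

/-- The half-size label set used by the pure cases: `{k : k < ⌈n/2⌉}` is in the window for `2 ≤ n`. -/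
theorem exists_window_set (n : ℕ) (hn : 2 ≤ n) :
    ∃ A : Finset (Fin n), n ≤ 3 * A.card ∧ 3 * A.card ≤ 2 * n := by
  refine ⟨(Finset.range ((n + 1) / 2)).attachFin (fun k hk => ?_), ?_⟩
  · have := Finset.mem_range.1 hk; omega
  · rw [Finset.card_attachFin, Finset.card_range]; omega

/-- **PURE CASE 1 (rows, label-row).**  If every row vertex of a cover of `per_n` (`2 ≤ n`) carries a
single label-row on its variable edges, a balanced vertex set exists: all columns together with the
rows whose label-row is `< ⌈n/2⌉`. -/
theorem exists_balanced_of_rowPure_fst {m n : ℕ} (hn : 2 ≤ n) (E : Finset (Fin m × Fin m))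
    (a : Fin m × Fin m → MvPolynomial (Fin n × Fin n) ℂ)
    (ha : ∀ e, (∃ j, a e = MvPolynomial.X j) ∨ a e = 0 ∨ a e = 1)
    (hper : Literature.Computability.AlgebraicComplexity.perPoly (Fin n) ℂ =
      MvPolynomial.aeval a (Matrix.of fun i j => if (i, j) ∈ E then MvPolynomial.X (i, j) else 0 :
          Matrix (Fin m) (Fin m) (MvPolynomial (Fin m × Fin m) ℂ)).permanent)
    (hpure : ∀ i : Fin m, ∃ k : Fin n, ∀ c j, (i, c) ∈ E → a (i, c) = MvPolynomial.X j → j.1 = k) :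
    ∃ S : Finset (Fin m ⊕ Fin m),
      ∀ τ : Equiv.Perm (Fin m), (∀ i, (i, τ i) ∈ E ∧ a (i, τ i) ≠ 0) →
        n ≤ 3 * (univ.filter fun i : Fin m =>
            Sum.inl i ∈ S ∧ Sum.inr (τ i) ∈ S ∧ ∃ j, a (i, τ i) = MvPolynomial.X j).card ∧
        3 * (univ.filter fun i : Fin m =>
            Sum.inl i ∈ S ∧ Sum.inr (τ i) ∈ S ∧ ∃ j, a (i, τ i) = MvPolynomial.X j).card ≤ 2 * n := by
  obtain ⟨A, hA⟩ := exists_window_set n hn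
  choose κ hκ using hpure
  refine ⟨univ.filter fun v => Sum.elim (fun i => κ i ∈ A) (fun _ => True) v, fun τ hτ => ?_⟩
  rw [card_inside_eq_of_fst_closed E a ha hper τ hτ _ A fun i j hj => by
    simp only [mem_filter, mem_univ, true_and, Sum.elim_inl, Sum.elim_inr, and_true]
    rw [← hκ i (τ i) j (hτ i).1 hj]]
  exact hA

/-- **PURE CASE 2 (rows, label-column).**  If every row vertex carries a single label-column on its
variable edges (`2 ≤ n`), a balanced vertex set exists. -/
theorem exists_balanced_of_rowPure_snd {m n : ℕ} (hn : 2 ≤ n) (E : Finset (Fin m × Fin m))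
    (a : Fin m × Fin m → MvPolynomial (Fin n × Fin n) ℂ)
    (ha : ∀ e, (∃ j, a e = MvPolynomial.X j) ∨ a e = 0 ∨ a e = 1)
    (hper : Literature.Computability.AlgebraicComplexity.perPoly (Fin n) ℂ =
      MvPolynomial.aeval a (Matrix.of fun i j => if (i, j) ∈ E then MvPolynomial.X (i, j) else 0 :
          Matrix (Fin m) (Fin m) (MvPolynomial (Fin m × Fin m) ℂ)).permanent)
    (hpure : ∀ i : Fin m, ∃ k : Fin n, ∀ c j, (i, c) ∈ E → a (i, c) = MvPolynomial.X j → j.2 = k) :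
    ∃ S : Finset (Fin m ⊕ Fin m),
      ∀ τ : Equiv.Perm (Fin m), (∀ i, (i, τ i) ∈ E ∧ a (i, τ i) ≠ 0) →
        n ≤ 3 * (univ.filter fun i : Fin m =>
            Sum.inl i ∈ S ∧ Sum.inr (τ i) ∈ S ∧ ∃ j, a (i, τ i) = MvPolynomial.X j).card ∧
        3 * (univ.filter fun i : Fin m =>
            Sum.inl i ∈ S ∧ Sum.inr (τ i) ∈ S ∧ ∃ j, a (i, τ i) = MvPolynomial.X j).card ≤ 2 * n := by
  obtain ⟨A, hA⟩ := exists_window_set n hn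
  choose κ hκ using hpure
  refine ⟨univ.filter fun v => Sum.elim (fun i => κ i ∈ A) (fun _ => True) v, fun τ hτ => ?_⟩
  rw [card_inside_eq_of_snd_closed E a ha hper τ hτ _ A fun i j hj => by
    simp only [mem_filter, mem_univ, true_and, Sum.elim_inl, Sum.elim_inr, and_true]
    rw [← hκ i (τ i) j (hτ i).1 hj]]
  exact hA

/-- **PURE CASE 3 (columns, label-row).**  If every column vertex receives a single label-row on its
variable edges (`2 ≤ n`) — in particular after the label-preserving even subdivision of all variable
edges, when each new column endpoint carries one label — a balanced vertex set exists: all rows together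
with the columns whose label-row is `< ⌈n/2⌉`. -/
theorem exists_balanced_of_colPure_fst {m n : ℕ} (hn : 2 ≤ n) (E : Finset (Fin m × Fin m))
    (a : Fin m × Fin m → MvPolynomial (Fin n × Fin n) ℂ)
    (ha : ∀ e, (∃ j, a e = MvPolynomial.X j) ∨ a e = 0 ∨ a e = 1)
    (hper : Literature.Computability.AlgebraicComplexity.perPoly (Fin n) ℂ =
      MvPolynomial.aeval a (Matrix.of fun i j => if (i, j) ∈ E then MvPolynomial.X (i, j) else 0 :
          Matrix (Fin m) (Fin m) (MvPolynomial (Fin m × Fin m) ℂ)).permanent)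
    (hpure : ∀ c : Fin m, ∃ k : Fin n, ∀ i j, (i, c) ∈ E → a (i, c) = MvPolynomial.X j → j.1 = k) :
    ∃ S : Finset (Fin m ⊕ Fin m),
      ∀ τ : Equiv.Perm (Fin m), (∀ i, (i, τ i) ∈ E ∧ a (i, τ i) ≠ 0) →
        n ≤ 3 * (univ.filter fun i : Fin m =>
            Sum.inl i ∈ S ∧ Sum.inr (τ i) ∈ S ∧ ∃ j, a (i, τ i) = MvPolynomial.X j).card ∧
        3 * (univ.filter fun i : Fin m =>
            Sum.inl i ∈ S ∧ Sum.inr (τ i) ∈ S ∧ ∃ j, a (i, τ i) = MvPolynomial.X j).card ≤ 2 * n := by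
  obtain ⟨A, hA⟩ := exists_window_set n hn
  choose κ hκ using hpure
  refine ⟨univ.filter fun v => Sum.elim (fun _ => True) (fun c => κ c ∈ A) v, fun τ hτ => ?_⟩
  rw [card_inside_eq_of_fst_closed E a ha hper τ hτ _ A fun i j hj => by
    simp only [mem_filter, mem_univ, true_and, Sum.elim_inl, Sum.elim_inr, true_and]
    rw [← hκ (τ i) i j (hτ i).1 hj]]
  exact hA

/-- **PURE CASE 4 (columns, label-column).**  If every column vertex receives a single label-column on
its variable edges (`2 ≤ n`), a balanced vertex set exists. -/
theorem exists_balanced_of_colPure_snd {m n : ℕ} (hn : 2 ≤ n) (E : Finset (Fin m × Fin m))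
    (a : Fin m × Fin m → MvPolynomial (Fin n × Fin n) ℂ)
    (ha : ∀ e, (∃ j, a e = MvPolynomial.X j) ∨ a e = 0 ∨ a e = 1)
    (hper : Literature.Computability.AlgebraicComplexity.perPoly (Fin n) ℂ =
      MvPolynomial.aeval a (Matrix.of fun i j => if (i, j) ∈ E then MvPolynomial.X (i, j) else 0 :
          Matrix (Fin m) (Fin m) (MvPolynomial (Fin m × Fin m) ℂ)).permanent)
    (hpure : ∀ c : Fin m, ∃ k : Fin n, ∀ i j, (i, c) ∈ E → a (i, c) = MvPolynomial.X j → j.2 = k) :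
    ∃ S : Finset (Fin m ⊕ Fin m),
      ∀ τ : Equiv.Perm (Fin m), (∀ i, (i, τ i) ∈ E ∧ a (i, τ i) ≠ 0) →
        n ≤ 3 * (univ.filter fun i : Fin m =>
            Sum.inl i ∈ S ∧ Sum.inr (τ i) ∈ S ∧ ∃ j, a (i, τ i) = MvPolynomial.X j).card ∧
        3 * (univ.filter fun i : Fin m =>
            Sum.inl i ∈ S ∧ Sum.inr (τ i) ∈ S ∧ ∃ j, a (i, τ i) = MvPolynomial.X j).card ≤ 2 * n := by
  obtain ⟨A, hA⟩ := exists_window_set n hn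
  choose κ hκ using hpure
  refine ⟨univ.filter fun v => Sum.elim (fun _ => True) (fun c => κ c ∈ A) v, fun τ hτ => ?_⟩
  rw [card_inside_eq_of_snd_closed E a ha hper τ hτ _ A fun i j hj => by
    simp only [mem_filter, mem_univ, true_and, Sum.elim_inl, Sum.elim_inr, true_and]
    rw [← hκ (τ i) i j (hτ i).1 hj]]
  exact hA

end Summit.ValiantsHypothesis.ValiantsHypothesis.Theorems.PolyaContinuedMonotoneCoverHard
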